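import Summits.QuantumFields.BalabanUV.T4Continuum.Support.VariationalPlancherel
import Summits.QuantumFields.BalabanUV.T4Continuum.Support.VariationalOpNorm
import Summits.QuantumFields.BalabanUV.T4Continuum.Spine.CovariantAveragingTower

/-!
# T⁴ programme, spine node NE2 (U1a), lane P2 — THE TIER-0 TOWER: the variational route delivered in ROW NE2's CONSUMER CURRENCY
# `CovariantAveragingTower.OneStepAveragedLaw` for Bałaban's `U = 1` effective actions, modulo the ONE open leaf L0-REG
# (`t4/skeletons/NE2-t4-ne2-p2.md` §3; cell `pub-balaban`, row NE2 co-owner #2, lineage t4-ne2-p2 gen 9)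

HONEST FRAMING (T4-DAG p. 1): rung (B)+1 only — NOT infinite volume, NOT a mass gap, NOT Clay.  `U = 1` torus bookkeeping; the
conclusion (the η-rate `L^{−2k}` of Bałaban's `U = 1` effective action in operator norm on the unit torus) is ALREADY a tree theorem
by the Fourier route (`B5ActionRate166`, `T4GaugeActionRate`); here it is re-derived along the VARIATIONAL route from the single
typed leaf `VariationalLeaves.MinimiserRegularityL2` (OPEN) — the value being the background template of the skeleton's tier ⁺.
Nothing printed is a hypothesis; no `sorry`.  HONEST DEPENDENCY (cell, verbatim): continuum YM on T⁴ ⇐ BetaPertH ∧ nine spine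
estimates (0/9 proved); BetaPertH ⇐ (D1) ∧ (D4) ∧ CAP+tail; G-an2-4 gates asym, D1 and NE2/3/4.

* §1 `blockSpin_equiv` (transport of the block-spin map along a relabelling of the fine fields) and **L0-DICT2**
  `effActionSucc_eq_effAction`: the (k+1)-step value through the composed average `Q_k ∘ Q` on `Tor (fine L (fine n M))` IS the
  (k+1)-step value on `Tor (fine (n·L) M)` (tree `B5Composition116.QvOp_comp_mulVec`, `sites`).
* §2 `effMat n M` — THE MATRIX of `Δ_k` on the unit torus (`n^{−d}·H_kᴴ(∂*∂)H_k`), `effMat_isHermitian`, `re_form_effMat`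
  (`re B†(effMat)B = effAction n M B`), the a-priori bound `re B†(effMat)B ≤ 8d²·(π²/4)^{2d+4}·Σ|B_i|²` ((1.67) upper + crude curl bound).
* §3 **`opNorm_effMat_succ_sub_le`**: `MinimiserRegularityL2 d C_reg ⟹ ‖effMat (L^{k+1}) M − effMat (L^k) M‖ ≤ Cop·(L⁻²)^k` with
  `Cop = 3γ₀⁻⁶(π⁴/32)·C_reg·8d²(π²/4)^{2d+4}`, and **`oneStepAveragedLaw_effMat`**: the same as
  `OneStepAveragedLaw (fun _ ↦ 1) 1 (fun k ↦ effMat (L^k) M) (fun k ↦ Cop·(L⁻²)^k)` — row NE2's wall shape, X8 species, `U = 1`.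
-/

noncomputable section

namespace Summit.QuantumFields.BalabanUV.T4Continuum.VariationalTower

open scoped Matrix ComplexConjugate BigOperators Matrix.Norms.L2Operator
open Summit.QuantumFields.BalabanUV.T4Continuum.VariationalTransfer
open Summit.QuantumFields.BalabanUV.T4Continuum.VariationalLeaves
open Summit.QuantumFields.BalabanUV.T4Continuum.VariationalPlancherel
open Summit.QuantumFields.BalabanUV.T4Continuum.VariationalOpNorm
open Summit.QuantumFields.BalabanUV.T4Continuum.CovariantAveragingTower (OneStepAveragedLaw)
open Literature.MathematicalPhysics.QuantumFieldTheory.Balaban1983to89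
open Literature.MathematicalPhysics.QuantumFieldTheory.Balaban1983to89.B5Prop11Plancherel (Tor fine unitVec)
open Literature.MathematicalPhysics.QuantumFieldTheory.Balaban1983to89.B5Action121 (star_mulVec_dotProduct)
open Literature.MathematicalPhysics.QuantumFieldTheory.Balaban1983to89.B5Block118 (QvOp tstep tstep_succ tstep_zero)
open Literature.MathematicalPhysics.QuantumFieldTheory.Balaban1983to89.B5Hk163Torus (HkOp QvOp_HkOp_mulVec)
open Literature.MathematicalPhysics.QuantumFieldTheory.Balaban1983to89.B5Hk163RDiv (DstarD DstarD_conjTranspose HkOp_minimum)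
open Literature.MathematicalPhysics.QuantumFieldTheory.Balaban1983to89.B5Hk164Transl (cEnergy cEnergy_nonneg)
open Literature.MathematicalPhysics.QuantumFieldTheory.Balaban1983to89.B5AverageCurlStokes (plaq plaq_apply)
open Literature.MathematicalPhysics.QuantumFieldTheory.Balaban1983to89.B5Bounds167Lattice (formDk d1Sq curl ineq167)
open Literature.MathematicalPhysics.QuantumFieldTheory.Balaban1983to89.B5Composition116 (sites sitesV sitesV_symm_apply
  QvOp_comp_mulVec fine_fine recast recast_add recast_tstep)
open Literature.MathematicalPhysics.QuantumFieldTheory.Balaban1983to89.T4GaugeActionRate (gam0 gam0_pos)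

variable {d : ℕ}

/-! ## §1 Transport of the block-spin map and L0-DICT2 -/

/-- relabelling the fine fields along a bijection compatible with the average and the action does not change the block-spin
value. [folklore] -/
theorem blockSpin_equiv {V V' W : Type*} (φ : V ≃ V') {Q : V → W} {Q' : V' → W} {S : V → ℝ} {S' : V' → ℝ}
    (hQ : ∀ A, Q' (φ A) = Q A) (hS : ∀ A, S' (φ A) = S A) (B : W) : blockSpin Q' S' B = blockSpin Q S B := by
  unfold blockSpin
  congr 1
  ext r
  constructor
  · rintro ⟨A', hA', rfl⟩
    refine ⟨φ.symm A', ?_, ?_⟩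
    · have := hQ (φ.symm A'); rw [φ.apply_symm_apply] at this; simpa [fib] using this.symm.trans hA'
    · have := hS (φ.symm A'); rw [φ.apply_symm_apply] at this; exact this.symm
  · rintro ⟨A, hA, rfl⟩
    exact ⟨φ A, by simpa [fib, hQ A] using hA, hS A⟩

section dict

variable (n L : ℕ) [NeZero n] [NeZero L] (M : Fin d → ℕ) [hM : ∀ μ, NeZero (M μ)]

omit [NeZero n] [NeZero L] hM in
/-- the site relabelling fixes unit vectors. [folklore] -/
theorem sites_unitVec (μ : Fin d) : sites n L M (unitVec (fine (n * L) M) μ) = unitVec (fine L (fine n M)) μ := by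
  have h1 : ∀ (N : Fin d → ℕ), unitVec N μ = tstep N μ 1 := fun N => by
    rw [show (1 : ℕ) = 0 + 1 from rfl, tstep_succ, tstep_zero, zero_add]
  rw [h1, h1]
  exact recast_tstep (fine_fine n L M) μ 1

omit [NeZero n] [NeZero L] hM in
/-- the plaquette sums are transported by the relabelling. [folklore] -/
theorem plaq_sites (A : Tor (fine (n * L) M) × Fin d → ℂ) (μ ν : Fin d) (x : Tor (fine (n * L) M)) :
    plaq (fine L (fine n M)) (A ∘ (sitesV n L M).symm) μ ν (sites n L M x) = plaq (fine (n * L) M) A μ ν x := by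
  rw [plaq_apply, plaq_apply]
  have hs : ∀ (y : Tor (fine (n * L) M)) (κ : Fin d), (A ∘ (sitesV n L M).symm) (sites n L M y, κ) = A (y, κ) := by
    intro y κ
    simp only [Function.comp_apply, sitesV_symm_apply, Equiv.symm_apply_apply]
  have hadd : ∀ κ, sites n L M x + unitVec (fine L (fine n M)) κ = sites n L M (x + unitVec (fine (n * L) M) κ) := by
    intro κ
    rw [← sites_unitVec n L M κ]
    exact (recast_add (fine_fine n L M) x _).symm
  rw [hadd, hadd, hs, hs, hs, hs]

/-- the fine energies agree: `Sfine n L M (A ∘ sitesV⁻¹) = Sphys (n·L) M A`. [folklore] -/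
theorem Sfine_comp_sitesV (A : Tor (fine (n * L) M) × Fin d → ℂ) :
    Sfine n L M (A ∘ (sitesV n L M).symm) = Sphys (n * L) M A := by
  unfold Sfine Sphys
  rw [cEnergy_eq_plaq, cEnergy_eq_plaq]
  have hsum : ∀ μ ν : Fin d, ∑ x' : Tor (fine L (fine n M)), ‖plaq (fine L (fine n M)) (A ∘ (sitesV n L M).symm) μ ν x'‖ ^ 2
      = ∑ x : Tor (fine (n * L) M), ‖plaq (fine (n * L) M) A μ ν x‖ ^ 2 := by
    intro μ ν
    rw [← Equiv.sum_comp (sites n L M)]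
    simp_rw [plaq_sites]
  simp_rw [hsum]
  push_cast
  have hn : (n : ℝ) ≠ 0 := by exact_mod_cast NeZero.ne n
  have hL : (L : ℝ) ≠ 0 := by exact_mod_cast NeZero.ne L
  rw [mul_pow]
  field_simp

/-- **L0-DICT2: `Δ_{k+1}` through the composed average IS `Δ_{k+1}`**: `effActionSucc n L M B = effAction (n·L) M B`.
[cite: Balaban1984PropagatorsI, (1.16)–(1.18) p.20] -/
theorem effActionSucc_eq_effAction (B : Tor M × Fin d → ℂ) : effActionSucc n L M B = effAction (n * L) M B := by
  unfold effActionSucc effAction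
  symm
  refine blockSpin_equiv ((sitesV n L M).symm.arrowCongr (Equiv.refl ℂ)) (fun A => ?_) (fun A => ?_) B
  · -- `A` a field on `Tor (fine L (fine n M))`; its transport `A ∘ sitesV` a field on `Tor (fine (n·L) M)`
    have harr : (sitesV n L M).symm.arrowCongr (Equiv.refl ℂ) A = A ∘ (sitesV n L M) := by
      funext i; simp [Equiv.arrowCongr_apply]
    rw [harr]
    show QvOp (n * L) M *ᵥ (A ∘ sitesV n L M) = QvOp n M *ᵥ (QvOp L (fine n M) *ᵥ A)
    have hA : A = (A ∘ sitesV n L M) ∘ (sitesV n L M).symm := by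
      funext i; simp
    conv_rhs => rw [hA]
    funext b
    obtain ⟨y, μ⟩ := b
    exact (QvOp_comp_mulVec n L M (A ∘ sitesV n L M) y μ).symm
  · have harr : (sitesV n L M).symm.arrowCongr (Equiv.refl ℂ) A = A ∘ (sitesV n L M) := by
      funext i; simp [Equiv.arrowCongr_apply]
    rw [harr]
    show Sphys (n * L) M (A ∘ sitesV n L M) = Sfine n L M A
    have hA : A = (A ∘ sitesV n L M) ∘ (sitesV n L M).symm := by
      funext i; simp
    conv_rhs => rw [hA]
    exact (Sfine_comp_sitesV n L M _).symm

end dict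

/-! ## §2 The matrix of `Δ_k` on the unit torus -/

section mat

variable (n : ℕ) [NeZero n] (M : Fin d → ℕ) [hM : ∀ μ, NeZero (M μ)]

/-- THE MATRIX of the k-step effective action on unit-lattice fields (physical units): `n^{−d}·H_kᴴ(∂*∂)H_k`, whose quadratic form
is `⟨B, Δ_kB⟩` ((1.65)). [cite: Balaban1984PropagatorsI, (1.65) p.29] -/
def effMat : Matrix (Tor M × Fin d) (Tor M × Fin d) ℂ :=
  (((n : ℂ) ^ d)⁻¹) • ((HkOp n M)ᴴ * (DstarD n M * HkOp n M))

/-- `effMat` is Hermitian. [folklore] -/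
theorem effMat_isHermitian : (effMat n M).IsHermitian := by
  unfold effMat
  have hD : (DstarD n M).IsHermitian := DstarD_conjTranspose n M
  have h1 : ((HkOp n M)ᴴ * (DstarD n M * HkOp n M)).IsHermitian := by
    rw [← Matrix.mul_assoc]
    exact Matrix.isHermitian_conjTranspose_mul_mul (HkOp n M) hD
  have hc : star ((((n : ℂ) ^ d)⁻¹)) = (((n : ℂ) ^ d)⁻¹) := by simp
  unfold Matrix.IsHermitian at h1 ⊢
  rw [Matrix.conjTranspose_smul, h1, hc]

/-- the quadratic form of `effMat` is the effective action: `re (B† effMat B) = effAction n M B = Δ_k(B)`. [folklore] -/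
theorem re_form_effMat (B : Tor M × Fin d → ℂ) :
    (star B ⬝ᵥ (effMat n M *ᵥ B)).re = effAction n M B := by
  rw [effAction_eq]
  unfold effMat Sphys cEnergy
  rw [Matrix.smul_mulVec, dotProduct_smul, smul_eq_mul, ← Matrix.mulVec_mulVec, ← Matrix.mulVec_mulVec,
    ← star_mulVec_dotProduct]
  rw [show (((n : ℂ) ^ d)⁻¹) = ((((n : ℝ) ^ d)⁻¹ : ℝ) : ℂ) by push_cast; ring, Complex.re_ofReal_mul]

/-- a crude bound of the unit curl energy by the `ℓ²` norm: `d1Sq M B ≤ 8d·Σ_i |B_i|²`. [folklore] -/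
theorem d1Sq_le (B : Tor M × Fin d → ℂ) : d1Sq M B ≤ 8 * (d : ℝ) ^ 2 * ∑ i, ‖B i‖ ^ 2 := by
  unfold d1Sq
  have hcomp : ∀ κ : Fin d, ∑ x : Tor M, ‖B (x, κ)‖ ^ 2 ≤ ∑ i, ‖B i‖ ^ 2 := by
    intro κ
    rw [Fintype.sum_prod_type]
    exact Finset.sum_le_sum fun x _ =>
      Finset.single_le_sum (f := fun κ' => ‖B (x, κ')‖ ^ 2) (fun _ _ => by positivity) (Finset.mem_univ κ)
  have hshift : ∀ (κ μ : Fin d), ∑ x : Tor M, ‖B (x + unitVec M μ, κ)‖ ^ 2 = ∑ x : Tor M, ‖B (x, κ)‖ ^ 2 :=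
    fun κ μ => Fintype.sum_equiv (Equiv.addRight (unitVec M μ)) _ _ fun x => rfl
  have hterm : ∀ μ ν : Fin d, ∑ x, ‖curl M B μ ν x‖ ^ 2 ≤ 16 * ∑ i, ‖B i‖ ^ 2 := by
    intro μ ν
    have hpt : ∀ x, ‖curl M B μ ν x‖ ^ 2 ≤ 4 * (‖B (x, μ)‖ ^ 2 + ‖B (x + unitVec M μ, ν)‖ ^ 2
        + ‖B (x + unitVec M ν, μ)‖ ^ 2 + ‖B (x, ν)‖ ^ 2) := by
      intro x
      rw [← plaq_eq_curl, plaq_apply]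
      set a := B (x, μ); set b := B (x + unitVec M μ, ν); set c := B (x + unitVec M ν, μ); set e := B (x, ν)
      have hs : ‖a + b - c - e‖ ≤ ‖a‖ + ‖b‖ + ‖c‖ + ‖e‖ := by
        have h1 := norm_sub_le (a + b - c) e
        have h2 := norm_sub_le (a + b) c
        have h3 := norm_add_le a b
        linarith
      have h2 : ‖a + b - c - e‖ ^ 2 ≤ (‖a‖ + ‖b‖ + ‖c‖ + ‖e‖) ^ 2 := pow_le_pow_left₀ (norm_nonneg _) hs 2
      nlinarith [sq_nonneg (‖a‖ - ‖b‖), sq_nonneg (‖a‖ - ‖c‖), sq_nonneg (‖a‖ - ‖e‖), sq_nonneg (‖b‖ - ‖c‖),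
        sq_nonneg (‖b‖ - ‖e‖), sq_nonneg (‖c‖ - ‖e‖)]
    calc ∑ x, ‖curl M B μ ν x‖ ^ 2
        ≤ ∑ x, 4 * (‖B (x, μ)‖ ^ 2 + ‖B (x + unitVec M μ, ν)‖ ^ 2 + ‖B (x + unitVec M ν, μ)‖ ^ 2 + ‖B (x, ν)‖ ^ 2) :=
          Finset.sum_le_sum fun x _ => hpt x
      _ = 4 * (∑ x, ‖B (x, μ)‖ ^ 2 + ∑ x, ‖B (x + unitVec M μ, ν)‖ ^ 2 + ∑ x, ‖B (x + unitVec M ν, μ)‖ ^ 2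
          + ∑ x, ‖B (x, ν)‖ ^ 2) := by
          rw [← Finset.mul_sum]; simp only [Finset.sum_add_distrib]
      _ ≤ 4 * (∑ i, ‖B i‖ ^ 2 + ∑ i, ‖B i‖ ^ 2 + ∑ i, ‖B i‖ ^ 2 + ∑ i, ‖B i‖ ^ 2) := by
          rw [hshift ν μ, hshift μ ν]
          gcongr <;> exact hcomp _
      _ = 16 * ∑ i, ‖B i‖ ^ 2 := by ring
  calc 1 / 2 * ∑ μ : Fin d, ∑ ν : Fin d, ∑ x, ‖curl M B μ ν x‖ ^ 2
      ≤ 1 / 2 * ∑ μ : Fin d, ∑ ν : Fin d, 16 * ∑ i, ‖B i‖ ^ 2 := by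
        gcongr with μ _ ν _
        exact hterm μ ν
    _ = 8 * (d : ℝ) ^ 2 * ∑ i, ‖B i‖ ^ 2 := by
        simp only [Finset.sum_const, Finset.card_univ, Fintype.card_fin, nsmul_eq_mul]
        ring

end mat

/-! ## §3 The tower in the consumer's currency -/

section tower

variable (M : Fin d → ℕ) [hM : ∀ μ, NeZero (M μ)]

/-- the a-priori bound (1.67) in `ℓ²` form: `⟨B, Δ_kB⟩ ≤ 8d²·(π²/4)^{2d+4}·Σ|B_i|²` (tree `B5Bounds167Lattice.ineq167` + `d1Sq_le`).
[cite: Balaban1984PropagatorsI, (1.67) p.29] -/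
theorem form_effMat_le (n : ℕ) [NeZero n] (B : Tor M × Fin d → ℂ) :
    (star B ⬝ᵥ (effMat n M *ᵥ B)).re ≤ 8 * (d : ℝ) ^ 2 * (Real.pi ^ 2 / 4) ^ (2 * d + 4) * ∑ i, ‖B i‖ ^ 2 := by
  have hn : 1 ≤ n := Nat.one_le_iff_ne_zero.mpr (NeZero.ne n)
  rw [re_form_effMat, effAction_eq_formDk]
  have h1 := (ineq167 (n := n) M hn B).2
  have h2 := d1Sq_le M B
  have hγ : 0 ≤ (Real.pi ^ 2 / 4 : ℝ) ^ (2 * d + 4) := by positivity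
  calc formDk n M B ≤ (Real.pi ^ 2 / 4) ^ (2 * d + 4) * d1Sq M B := h1
    _ ≤ (Real.pi ^ 2 / 4) ^ (2 * d + 4) * (8 * (d : ℝ) ^ 2 * ∑ i, ‖B i‖ ^ 2) := mul_le_mul_of_nonneg_left h2 hγ
    _ = _ := by ring

/-- the explicit tower constant `Cop = 3γ₀⁻⁶(π⁴/32)·C_reg·8d²(π²/4)^{2d+4}`. [folklore] -/
def Cop (d : ℕ) (Creg : ℝ) : ℝ :=
  3 / gam0 d ^ 6 * (Real.pi ^ 4 / 32) * Creg * (8 * (d : ℝ) ^ 2 * (Real.pi ^ 2 / 4) ^ (2 * d + 4))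

/-- **THE TOWER RATE IN OPERATOR NORM** (variational route, `U = 1`, effective-action species X8): from the L²-regularity leaf
ALONE, `‖effMat (L^{k+1}) M − effMat (L^k) M‖ ≤ Cop·(L⁻²)^k` on every unit torus, every `k`. [folklore] -/
theorem opNorm_effMat_succ_sub_le (L : ℕ) [NeZero L] {Creg : ℝ} (hreg : MinimiserRegularityL2 d Creg) (hC : 0 ≤ Creg)
    (k : ℕ) : ‖effMat (L ^ (k + 1)) M - effMat (L ^ k) M‖ ≤ Cop d Creg * (((L : ℝ) ^ 2)⁻¹) ^ k := by
  have hL : 1 ≤ L := Nat.one_le_iff_ne_zero.mpr (NeZero.ne L)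
  have hK : 0 ≤ 3 / gam0 d ^ 6 * (Real.pi ^ 4 / 32) * Creg := by have := gam0_pos d; positivity
  have hε : 0 ≤ 3 / gam0 d ^ 6 * (Real.pi ^ 4 / 32) * Creg * (((L : ℝ) ^ 2)⁻¹) ^ k := by positivity
  have hΛ : 0 ≤ 8 * (d : ℝ) ^ 2 * (Real.pi ^ 2 / 4) ^ (2 * d + 4) := by positivity
  have key := opNorm_sub_le_of_form_sandwich (effMat_isHermitian (L ^ k) M) (effMat_isHermitian (L ^ (k + 1)) M) hε hΛ
    (fun B => ?_) (fun B => ?_) (fun B => form_effMat_le M (L ^ k) B)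
  · exact key.trans_eq (by unfold Cop; ring)
  all_goals
    have hrate := effAction_rate_of_regularity L M hreg hL k B
    rw [effActionSucc_eq_effAction] at hrate
    rw [Matrix.sub_mulVec, dotProduct_sub, Complex.sub_re, re_form_effMat, re_form_effMat]
    have hpow : effAction (L ^ (k + 1)) M B = effAction (L ^ k * L) M B := rfl
    rw [hpow]
  · exact hrate.1
  · exact hrate.2

/-- **ROW NE2's WALL SHAPE, INHABITED ALONG THE VARIATIONAL ROUTE (modulo L0-REG)**: the tower `k ↦ effMat (L^k) M` of Bałaban's
`U = 1` effective actions on the unit torus obeys `OneStepAveragedLaw (fun _ ↦ 1) 1 (k ↦ Δ_k) (k ↦ Cop·(L⁻²)^k)` — identity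
averagings (the effective actions already live on the unit lattice), rate `θ = L⁻²`. [folklore] -/
theorem oneStepAveragedLaw_effMat (L : ℕ) [NeZero L] {Creg : ℝ} (hreg : MinimiserRegularityL2 d Creg) (hC : 0 ≤ Creg) :
    OneStepAveragedLaw (ι := fun _ => Tor M × Fin d) (fun _ => (1 : Matrix (Tor M × Fin d) (Tor M × Fin d) ℂ)) 1
      (fun k => effMat (L ^ k) M) (fun k => Cop d Creg * (((L : ℝ) ^ 2)⁻¹) ^ k) := by
  intro k
  simp only [Matrix.conjTranspose_one, Matrix.mul_one, Complex.ofReal_one, inv_one, one_smul, one_mul]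
  exact opNorm_effMat_succ_sub_le M L hreg hC k

end tower

end Summit.QuantumFields.BalabanUV.T4Continuum.VariationalTower
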